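import Summits.BirchSwinnertonDyer.BirchSwinnertonDyer.Theorems.ClassRecordThreeEulerHalvesAtThreeCartanCuspNoFixedVector
import HarnessLib

/-!
# Crux 23422 ∕ 19109, line `cartan` (v13: one open stub NUM = `CartanOnePlaceDegreeLawAtThree`) — the FINITE-GROUP HALF of the
# principal-series case of the mod-3 lattice clause: **two subgroups of order prime to `ℓ` + a saturation hypothesis ⇒ no fixed vector mod `ℓ`**

Seat `bsd-idea-10` g14 (ideator, lens = transfer; `--supports stmt-BirchSwinnertonDyer-19109 --as helper`). Companion of
`…CartanCuspNoFixedVector` (p710975: at CUSPIDAL primes `q ≡ 2 (mod 3)` the clause `noFixedVectorModThree` of `CartanDegree.CartanTorusLattice`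
is automatic). At PRINCIPAL-SERIES primes `q ≡ 1 (mod 3)` it is NOT automatic (both mod-3 lattice classes exist); the paper reduction
(`Cruxes/EulerHalvesAtThree/NUM-VETTING.md` §B1–B2, refereeing tam3-p1's `NUM-PROOF-SKETCH.md` §4) splits it into
* a FINITE-GROUP LEMMA (this file): if `H₁, H₂ ≤ G` have orders prime to `ℓ` and the fixed sublattices satisfy the saturation hypothesis
  (SAT_ℓ) `a₁ ∈ 𝓛^{H₁}, a₂ ∈ 𝓛^{H₂}, a₁ + a₂ ∈ ℓ𝓛 ⇒ a₁ ∈ ℓ𝓛`, then every vector fixed modulo `ℓ` by `H₁` and by `H₂` lies in `ℓ𝓛`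
  (`exists_eq_smul_of_fixedMod_pair`; four lines: average over `H_i` and use Bézout, `exists_fixed_sub_eq_smul`); specialised to
  `G = GL₂(𝔽_q)`, `ℓ = 3`, `H₁ = ⟨uU⟩`, `H₂ = ⟨uL⟩` for unipotents `uU = (1 1; 0 1)`, `uL = (1 0; 1 1)` (order `q`, prime to `3` for every
  prime `q ≠ 3`; NO new definition — the unipotents enter as elements with a hypothesis on their matrix, as in `…TorusCubeCutPSUnipotent`):
  **`noFixedVectorModThree_of_unipotentSaturated`** — the `noFixedVectorModThree` clause follows from (SAT₃) for the two unipotent lines;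
* a GEOMETRIC saturation statement (SAT₃) for the Hom-lattice `Hom_ℚ(J̄, E₀)` (an Ihara-type lemma inside one Galois cover, reduced in the memo to
  Hochschild–Serre + good reduction of `X_G` at `q` + Néron–Ogg–Shafarevich + Serre–Tate) — NOT in this file, not a Lean statement anywhere yet.
HONEST FRAMING: finite-group averaging only. NUM, (F2b♭), crux 23422, crux 19109 are NOT proved here; no route item and no registered stub is
proved; no summit statement is proved; BSD is proved for no curve. [folklore]
-/

namespace Summit.BirchSwinnertonDyer.BirchSwinnertonDyer.Theorems.CartanSupply.PSNoFixed

open Summit.BirchSwinnertonDyer.BirchSwinnertonDyer.Theorems.CartanDegree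
open Summit.BirchSwinnertonDyer.BirchSwinnertonDyer.Theorems.CartanTorusCubeCut
open Summit.BirchSwinnertonDyer.BirchSwinnertonDyer.Theorems.CartanSupply.CuspNoFixed
open scoped Classical

set_option linter.dupNamespace false
set_option autoImplicit false

/-! ## §1 Generic: averaging over a subgroup of order prime to `ℓ`; two such subgroups + (SAT_ℓ) ⇒ no fixed vector mod `ℓ` -/

section generic

variable {G : Type*} [Group G] {d : ℕ} (ρ : Representation ℤ G (Fin d → ℤ))

/-- PROVED (averaging + Bézout): if `gcd(|H|, ℓ) = 1` and `v` is fixed by `H` modulo `ℓ𝓛`, then `v ≡ v'  (mod ℓ𝓛)` for some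
`H`-fixed `v'` (namely `v' = a·Σ_{h∈H} h·v` with `a|H| + bℓ = 1`). [folklore] -/
theorem exists_fixed_sub_eq_smul (H : Subgroup G) [Fintype H] (ℓ : ℤ) (hcop : IsCoprime (Fintype.card H : ℤ) ℓ)
    (v : Fin d → ℤ) (hv : ∀ h : H, ∃ w : Fin d → ℤ, ρ (h : G) v - v = ℓ • w) :
    ∃ v' ∈ fixedSub ρ H, ∃ u : Fin d → ℤ, v - v' = ℓ • u := by
  choose w hw using hv
  have hrw : ∀ h : H, ρ (h : G) v = v + ℓ • w h := fun h => by rw [← hw h]; abel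
  have hS : ∑ h : H, ρ (h : G) v = (Fintype.card H : ℤ) • v + ℓ • ∑ h : H, w h := by
    rw [natCast_zsmul]
    simp only [hrw, Finset.sum_add_distrib, Finset.sum_const, Finset.card_univ, Finset.smul_sum]
  obtain ⟨a, b, hab⟩ := hcop
  refine ⟨a • ∑ h : H, ρ (h : G) v, (fixedSub ρ H).smul_mem a (sum_mem_fixedSub ρ H v),
    b • v - a • ∑ h : H, w h, ?_⟩
  rw [hS]
  calc v - a • ((Fintype.card H : ℤ) • v + ℓ • ∑ h : H, w h)
        = (a * (Fintype.card H : ℤ) + b * ℓ) • v - a • ((Fintype.card H : ℤ) • v + ℓ • ∑ h : H, w h) := by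
          rw [hab, one_smul]
    _ = ℓ • (b • v - a • ∑ h : H, w h) := by module

/-- PROVED — **TWO 3′-SUBGROUPS + SATURATION ⇒ NO FIXED VECTOR MOD `ℓ`** (memo §B1): let `H₁, H₂ ≤ G` have orders prime to `ℓ` and assume
(SAT_ℓ): `a₁ ∈ 𝓛^{H₁}`, `a₂ ∈ 𝓛^{H₂}`, `a₁ + a₂ ∈ ℓ𝓛` ⇒ `a₁ ∈ ℓ𝓛`. Then every `v` fixed modulo `ℓ` by `H₁` and by `H₂` lies in `ℓ𝓛`.
Proof: `v ≡ v₁ ≡ v₂` with `v_i ∈ 𝓛^{H_i}` (previous lemma), so `v₁ + (−v₂) ∈ ℓ𝓛`, (SAT_ℓ) gives `v₁ ∈ ℓ𝓛`, hence `v ∈ ℓ𝓛`. [folklore] -/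
theorem exists_eq_smul_of_fixedMod_pair (H₁ H₂ : Subgroup G) [Fintype H₁] [Fintype H₂] (ℓ : ℤ)
    (h₁ : IsCoprime (Fintype.card H₁ : ℤ) ℓ) (h₂ : IsCoprime (Fintype.card H₂ : ℤ) ℓ)
    (hsat : ∀ a₁ ∈ fixedSub ρ H₁, ∀ a₂ ∈ fixedSub ρ H₂,
      (∃ w : Fin d → ℤ, a₁ + a₂ = ℓ • w) → ∃ w : Fin d → ℤ, a₁ = ℓ • w)
    (v : Fin d → ℤ) (hv₁ : ∀ h : H₁, ∃ w : Fin d → ℤ, ρ (h : G) v - v = ℓ • w)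
    (hv₂ : ∀ h : H₂, ∃ w : Fin d → ℤ, ρ (h : G) v - v = ℓ • w) :
    ∃ w : Fin d → ℤ, v = ℓ • w := by
  obtain ⟨v₁, hv₁F, u₁, hu₁⟩ := exists_fixed_sub_eq_smul ρ H₁ ℓ h₁ v hv₁
  obtain ⟨v₂, hv₂F, u₂, hu₂⟩ := exists_fixed_sub_eq_smul ρ H₂ ℓ h₂ v hv₂
  have hsum : ∃ w : Fin d → ℤ, v₁ + -v₂ = ℓ • w :=
    ⟨u₂ - u₁, by rw [smul_sub, ← hu₁, ← hu₂]; abel⟩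
  obtain ⟨w₁, hw₁⟩ := hsat v₁ hv₁F (-v₂) ((fixedSub ρ H₂).neg_mem hv₂F) hsum
  exact ⟨w₁ + u₁, by rw [smul_add, ← hw₁, ← hu₁]; abel⟩

/-- PROVED — the same with the hypothesis «fixed modulo `ℓ` by all of `G`», i.e. the shape of `CartanTorusLattice.noFixedVectorModThree`:
under (SAT_ℓ) for two 3′-subgroups, `(𝓛∕ℓ𝓛)^G = 0`. [folklore] -/
theorem noFixedVectorMod_of_pair (H₁ H₂ : Subgroup G) [Fintype H₁] [Fintype H₂] (ℓ : ℤ)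
    (h₁ : IsCoprime (Fintype.card H₁ : ℤ) ℓ) (h₂ : IsCoprime (Fintype.card H₂ : ℤ) ℓ)
    (hsat : ∀ a₁ ∈ fixedSub ρ H₁, ∀ a₂ ∈ fixedSub ρ H₂,
      (∃ w : Fin d → ℤ, a₁ + a₂ = ℓ • w) → ∃ w : Fin d → ℤ, a₁ = ℓ • w) :
    ∀ v : Fin d → ℤ, (∀ g : G, ∃ w : Fin d → ℤ, ρ g v - v = ℓ • w) → ∃ w : Fin d → ℤ, v = ℓ • w :=
  fun v hv => exists_eq_smul_of_fixedMod_pair ρ H₁ H₂ ℓ h₁ h₂ hsat v (fun h => hv h) (fun h => hv h)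

/-- PROVED: a vector fixed by the cyclic subgroup `⟨g⟩` is fixed by `g` (the direction used below). [folklore] -/
theorem apply_eq_self_of_mem_fixedSub_zpowers (g : G) {a : Fin d → ℤ} (ha : a ∈ fixedSub ρ (Subgroup.zpowers g)) :
    ρ g a = a :=
  ha ⟨g, Subgroup.mem_zpowers g⟩

end generic

/-! ## §2 `GL₂(𝔽_q)`: a unipotent `uU = (1 1; 0 1)` (resp. `uL = (1 0; 1 1)`) has order `q`; the corollary at `ℓ = 3`

No new definition (helper-file discipline, as in `…TorusCubeCutPSUnipotent`): the two unipotents enter as elements `uU uL : GL₂(𝔽_q)` with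
hypotheses `huU : uU = (1 1; 0 1)`, `huL : uL = (1 0; 1 1)` on their matrices; the subgroups are `Subgroup.zpowers uU`, `Subgroup.zpowers uL`. -/

section unipotent

variable {q : ℕ} [Fact q.Prime]

/-- PROVED: the powers of `uU = (1 1; 0 1)` are `(1 n; 0 1)`. [folklore] -/
theorem coe_pow_of_upper_unipotent (u : G q) (hu : ((u : G q) : Mat q) = !![1, 1; 0, 1]) (n : ℕ) :
    ((u ^ n : G q) : Mat q) = !![1, (n : ZMod q); 0, 1] := by
  induction n with
  | zero =>
      rw [pow_zero, Units.val_one, Nat.cast_zero]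
      ext i j; fin_cases i <;> fin_cases j <;> simp
  | succ n ih =>
      rw [pow_succ, Units.val_mul, ih, hu, Matrix.mul_fin_two, Nat.cast_succ]
      simp [add_comm]

/-- PROVED: the powers of `uL = (1 0; 1 1)` are `(1 0; n 1)`. [folklore] -/
theorem coe_pow_of_lower_unipotent (u : G q) (hu : ((u : G q) : Mat q) = !![1, 0; 1, 1]) (n : ℕ) :
    ((u ^ n : G q) : Mat q) = !![1, 0; (n : ZMod q), 1] := by
  induction n with
  | zero =>
      rw [pow_zero, Units.val_one, Nat.cast_zero]
      ext i j; fin_cases i <;> fin_cases j <;> simp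
  | succ n ih =>
      rw [pow_succ, Units.val_mul, ih, hu, Matrix.mul_fin_two, Nat.cast_succ]
      simp [add_comm]

/-- PROVED: `uU = (1 1; 0 1)` has order `q`. [folklore] -/
theorem orderOf_upper_unipotent (u : G q) (hu : ((u : G q) : Mat q) = !![1, 1; 0, 1]) : orderOf u = q := by
  apply orderOf_eq_prime
  · apply Units.ext
    rw [coe_pow_of_upper_unipotent u hu, ZMod.natCast_self, Units.val_one]
    ext i j; fin_cases i <;> fin_cases j <;> simp
  · intro h
    have h01 := congrArg (fun g : G q => (g : Mat q) 0 1) h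
    simp only [hu, Units.val_one, Matrix.one_apply_ne (show (0 : Fin 2) ≠ 1 by decide)] at h01
    simp at h01

/-- PROVED: `uL = (1 0; 1 1)` has order `q`. [folklore] -/
theorem orderOf_lower_unipotent (u : G q) (hu : ((u : G q) : Mat q) = !![1, 0; 1, 1]) : orderOf u = q := by
  apply orderOf_eq_prime
  · apply Units.ext
    rw [coe_pow_of_lower_unipotent u hu, ZMod.natCast_self, Units.val_one]
    ext i j; fin_cases i <;> fin_cases j <;> simp
  · intro h
    have h10 := congrArg (fun g : G q => (g : Mat q) 1 0) h
    simp only [hu, Units.val_one, Matrix.one_apply_ne (show (1 : Fin 2) ≠ 0 by decide)] at h10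
    simp at h10

/-- PROVED: such unipotents exist. [folklore] -/
theorem exists_unipotent_pair :
    ∃ uU uL : G q, ((uU : G q) : Mat q) = !![1, 1; 0, 1] ∧ ((uL : G q) : Mat q) = !![1, 0; 1, 1] :=
  ⟨Matrix.GeneralLinearGroup.mkOfDetNeZero !![1, 1; 0, 1] (by rw [Matrix.det_fin_two_of]; simp),
   Matrix.GeneralLinearGroup.mkOfDetNeZero !![1, 0; 1, 1] (by rw [Matrix.det_fin_two_of]; simp), rfl, rfl⟩

/-- PROVED: for a prime `q ≠ 3`, `q` is coprime to `3` (as integers). [folklore] -/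
theorem isCoprime_three_of_prime_ne (hq3 : q ≠ 3) : IsCoprime ((q : ℕ) : ℤ) 3 := by
  have h : Nat.Coprime q 3 := (Nat.coprime_primes (Fact.out : q.Prime) Nat.prime_three).mpr hq3
  exact Nat.isCoprime_iff_coprime.mpr h

/-- PROVED: the cyclic group generated by a unipotent of the given shape has order prime to `3` (`q ≠ 3`). [folklore] -/
theorem isCoprime_card_zpowers_three (hq3 : q ≠ 3) (u : G q) (hu : orderOf u = q) :
    IsCoprime (Fintype.card (Subgroup.zpowers u) : ℤ) 3 := by
  rw [← Nat.card_eq_fintype_card, Nat.card_zpowers, hu]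
  exact isCoprime_three_of_prime_ne hq3

/-- PROVED — **THE MOD-3 CLAUSE AT ANY PRIME `q ≠ 3` FROM UNIPOTENT SATURATION** (memo §B1 specialised): let `ρ` be a `ℤ`-representation of
`GL₂(𝔽_q)` on `ℤ^d`, `uU = (1 1; 0 1)`, `uL = (1 0; 1 1)`, and assume (SAT₃) for the two unipotent fixed lattices — whenever `a₁` is fixed by `uU`,
`a₂` is fixed by `uL` and `a₁ + a₂ ∈ 3ℤ^d`, already `a₁ ∈ 3ℤ^d`. Then `ρ` has no non-zero fixed vector mod `3`: the `noFixedVectorModThree` clause of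
`CartanDegree.CartanTorusLattice` holds. (No character hypothesis; at `q ≡ 2 (mod 3)` the hypothesis-free `CuspNoFixed.noFixedVectorModThree_of_cusp`
is stronger — this corollary is meant for `q ≡ 1 (mod 3)`, where (SAT₃) is the geometric input isolated in NUM-VETTING §B2.) [folklore] -/
theorem noFixedVectorModThree_of_unipotentSaturated (hq3 : q ≠ 3) {d : ℕ} (ρ : Representation ℤ (G q) (Fin d → ℤ))
    (uU uL : G q) (huU : ((uU : G q) : Mat q) = !![1, 1; 0, 1]) (huL : ((uL : G q) : Mat q) = !![1, 0; 1, 1])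
    (hsat : ∀ a₁ a₂ : Fin d → ℤ, ρ uU a₁ = a₁ → ρ uL a₂ = a₂ →
      (∃ w : Fin d → ℤ, a₁ + a₂ = (3 : ℤ) • w) → ∃ w : Fin d → ℤ, a₁ = (3 : ℤ) • w) :
    ∀ v : Fin d → ℤ, (∀ g, ∃ w : Fin d → ℤ, ρ g v - v = (3 : ℤ) • w) → ∃ w : Fin d → ℤ, v = (3 : ℤ) • w := by
  refine noFixedVectorMod_of_pair ρ (Subgroup.zpowers uU) (Subgroup.zpowers uL) 3
    (isCoprime_card_zpowers_three hq3 uU (orderOf_upper_unipotent uU huU))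
    (isCoprime_card_zpowers_three hq3 uL (orderOf_lower_unipotent uL huL)) ?_
  intro a₁ ha₁ a₂ ha₂ hsum
  exact hsat a₁ a₂ (apply_eq_self_of_mem_fixedSub_zpowers ρ uU ha₁)
    (apply_eq_self_of_mem_fixedSub_zpowers ρ uL ha₂) hsum

/-- PROVED — the same with the unipotents supplied (`exists_unipotent_pair`), hypothesis (SAT₃) quantified over them: a would-be constructor of a
`CartanTorusLattice q` at a principal-series prime may take its `noFixedVectorModThree` clause from here. [folklore] -/
theorem noFixedVectorModThree_of_unipotentSaturated' (hq3 : q ≠ 3) {d : ℕ} (ρ : Representation ℤ (G q) (Fin d → ℤ))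
    (hsat : ∀ uU uL : G q, ((uU : G q) : Mat q) = !![1, 1; 0, 1] → ((uL : G q) : Mat q) = !![1, 0; 1, 1] →
      ∀ a₁ a₂ : Fin d → ℤ, ρ uU a₁ = a₁ → ρ uL a₂ = a₂ →
      (∃ w : Fin d → ℤ, a₁ + a₂ = (3 : ℤ) • w) → ∃ w : Fin d → ℤ, a₁ = (3 : ℤ) • w)
    (v : Fin d → ℤ) (hv : ∀ g, ∃ w : Fin d → ℤ, ρ g v - v = (3 : ℤ) • w) : ∃ w : Fin d → ℤ, v = (3 : ℤ) • w := by
  obtain ⟨uU, uL, huU, huL⟩ := exists_unipotent_pair (q := q)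
  exact noFixedVectorModThree_of_unipotentSaturated hq3 ρ uU uL huU huL (hsat uU uL huU huL) v hv

end unipotent

end Summit.BirchSwinnertonDyer.BirchSwinnertonDyer.Theorems.CartanSupply.PSNoFixed
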